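import Summits.Parity.GeneralizedHardyLittlewood.Theorems.LeeYangFibresCellParityLawSavingEngineDefs
import Summits.Parity.GeneralizedHardyLittlewood.Theorems.LeeYangFibresCellParityLawPrLawTwoPrep
import Summits.Parity.GeneralizedHardyLittlewood.Theorems.LeeYangFibresCellParityLawSavingWalshStep
import Summits.Parity.GeneralizedHardyLittlewood.Theorems.LeeYangFibresAbsoluteUpgradeSingularProductLogLog
import Summits.Parity.GeneralizedHardyLittlewood.Theorems.LeeYangFibresAbsoluteUpgradeSlices
import Summits.Parity.GeneralizedHardyLittlewood.Theorems.LeeYangFibresAbsoluteUpgradeQuantClipNumerics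
import Literature.NumberTheory.Sieve.ParityWalshCube
import HarnessLib

/-!
# Route `LeeYangFibres`, crux `CellParityLawSaving` (stmt-Parity-18104),
# line `superpoly-band-same-atom`: the registered stub `stub_prepAlong` —
# preparations along the schedule

We prove `PrepAlong` (vocabulary file `LeeYangFibresCellParityLawSavingEngineDefs`, skeleton v2 of the
line): the three elementary inputs of the assembly of Bombieri's one-parameter section law ALONG THE
ROUGHNESS SCHEDULE `u = U(N) = slowDegree N` (`= max 4 ⌊√(log log N)/2⌋₊`), for a non-degenerate
one-dimensional system `Ψ = (ψ₀, …, ψ_t)` of size `‖Ψ‖_N ≤ L`, a coordinate `i` (frozen sub-system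
`Ψ₋ᵢ = Fin.removeNth i Ψ`) and frozen cells `j'`.

* (a) DEGENERATE CASES, for `N ≥ N₀(t, L)`: if the section density has a degenerate prime
  (`g_{Ψ,i}(p) = 1`) or `𝔖(Ψ₋ᵢ) = 0`, then every joint cell `C_{(m,j')}` at the coordinate `i` is empty
  and `H_{Ψ,i} · F⁽ⁱ⁾_{j'} = 0`. This is the sister crux's `stub_prLawTwoPrep` (a)
  (`LeeYangFibresCellParityLawPrLawTwoPrep`, fixed `u`, threshold `(max(t+1,L)+2)^u`) at `u := U(N)`:
  its pointwise lemmas (`goodCount_eq_zero_of_density_one`, `small_and_dvd_of_goodCount_eq_zero`,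
  `cell_eq_zero_of_forall_dvd`, `sectionH_eq_zero_of_density_one`, `cell_le_sectionMass`,
  `EulerRatioAux.exists_small_prime_dvd`, `EulerRatioAux.sectionMass_eq_zero`) only need
  `max(t+1, L) + 2 ≤ N^{1/U(N)}`, and along the schedule `N^{1/U(N)} → ∞`
  (`PrepAlongAux.exists_le_rpow_schedule`: `N^{1/U} = exp(log N/U) ≥ 1 + log N/U ≥ 1 + 4U` since
  `log N ≥ exp(4U²) ≥ 4U² + 1`, and `U ≥ U₀` eventually — `quantClip_schedule`).
* (b) EULER RATIO, same threshold: `𝔖(Ψ₋ᵢ) ≠ 0 → H_{Ψ,i} = 𝔖(Ψ)/𝔖(Ψ₋ᵢ)` is the sister's landed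
  `u`-free `EulerRatioAux.sectionH_eq` (prime-by-prime telescoping and Green–Tao 2010, Lemma 1.3), and
  `𝔖(Ψ₋ᵢ) = 0 →` every fibre mass at roughness `U(N)` vanishes (local obstruction at a prime
  `p ≤ max(t, L) < N^{1/U(N)}`).
* (c) FIBRE MASS: given the anatomy bounds along the schedule (`DensityBoundsAlong`:
  `a_m ≤ (log N)^{ε'}/log N`) and the law along the schedule for `t`-form systems (`LawSavAt t`, the
  induction hypothesis of `composeSav2`), for every `ε > 0` and `N ≥ N₀(t, L, ε)` every fibre mass is
  `F⁽ⁱ⁾_{j'} ≤ N (log N)^ε/log^t N`. Indeed `F⁽ⁱ⁾_{j'}` IS the `t`-form cell of `Ψ₋ᵢ` over the convex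
  half-body `K ∩ {ψ_i > 0}` (`WalshStepAux.sectionMass_one_eq_cell`), priced by `LawSavAt t` as
  `W_θ(j') · β_∞ 𝔖(Ψ₋ᵢ) ∏_k a_{j'_k} + O(N/(log^t N (log N)^δ))` with `|W_θ| ≤ 2^{t+1}`
  (`ParityWalsh.abs_walshSum_le`), `β_∞ ≤ 2N` (`archFactor_removeNth_inter`, `archFactor_le_two_mul`),
  `𝔖(Ψ₋ᵢ) ≤ C (log log N)^{t-1}` (`stub_singularProduct_le_loglog_pow`), `∏ a ≤ ((log N)^{ε/(4t)}/log N)^t`;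
  the total `(2^{t+2} C (log log N)^{t-1} (log N)^{ε/4} + 1) N/log^t N` is `≤ N (log N)^ε/log^t N` once
  `(log log N)^{t-1} ≤ (log N)^{ε/4}` and `2^{t+2} C + 2 ≤ (log N)^{ε/4}` (`WalshStepSavAux.exists_thresholds`;
  the arithmetic is `PrepAlongAux.budget_le`).

No number theory is used beyond the named landed facts and the two hypotheses of (c).

References: E. Bombieri, *The asymptotic sieve*, Rend. Accad. Naz. XL (5) 1/2 (1975/76) 243–269
[BombieriAsymptoticSieve1976]; E. Bombieri, RIMS Kokyuroku 294 (1977) p. 5 [BombieriRIMS1977];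
B. Green, T. Tao, *Linear equations in primes*, Ann. of Math. 171 (2010), Lemma 1.3, (1.4)
[GreenTao2010].
-/

noncomputable section

open scoped BigOperators Classical
open Finset Filter Literature.NumberTheory.Sieve
open Summit.Parity.GeneralizedHardyLittlewood.Cruxes.CellParityLaw.SectionAnnihilator
open Summit.Parity.GeneralizedHardyLittlewood.Cruxes.AbsoluteUpgrade.DipMarginRateExchange (slowDegree
  four_le_slowDegree quantClip_schedule)
open Summit.Parity.GeneralizedHardyLittlewood.Theorems.AbsoluteUpgrade (archFactor_le_two_mul
  stub_singularProduct_le_loglog_pow)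

namespace Summit.Parity.GeneralizedHardyLittlewood.Cruxes.CellParityLawSaving.SuperPolyBand

namespace PrepAlongAux

open PrLawTwoAux EulerRatioAux WalshStepAux WalshStepSavAux SingularRatio

/-! ## The sieving parameter `N^{1/U(N)}` tends to infinity along the schedule -/

/-- **`N^{1/U(N)} → ∞` along the schedule**: for every real `c`, eventually `c ≤ N^{1/U(N)}`.
With `U = slowDegree N ≥ 4`: `N^{1/U} = exp(log N/U) ≥ 1 + log N/U ≥ 1 + 4U ≥ U ≥ c`, because
`log N ≥ exp(4U²) ≥ 4U² + 1` and `U ≥ ⌈c⌉₊` for `N ≥ N₀` (`quantClip_schedule`). -/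
theorem exists_le_rpow_schedule (c : ℝ) :
    ∃ N₀ : ℕ, ∀ N : ℕ, N₀ ≤ N → c ≤ (N : ℝ) ^ ((1 : ℝ) / slowDegree N) := by
  obtain ⟨N₀, hN₀⟩ := quantClip_schedule ⌈c⌉₊
  refine ⟨N₀, fun N hN => ?_⟩
  obtain ⟨hcU, hN16, hexp, -⟩ := hN₀ N hN
  have hU4 : (4 : ℝ) ≤ slowDegree N := by exact_mod_cast four_le_slowDegree N
  have hUpos : (0 : ℝ) < slowDegree N := by linarith
  have hcU' : c ≤ slowDegree N := (Nat.le_ceil c).trans (by exact_mod_cast hcU)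
  have hN0 : (0 : ℝ) < N := by exact_mod_cast (by omega : 0 < N)
  have h4U2 : 4 * (slowDegree N : ℝ) ^ 2 + 1 ≤ Real.log N :=
    le_trans (Real.add_one_le_exp _) hexp
  have hlNU : 4 * (slowDegree N : ℝ) ≤ Real.log N / slowDegree N := by
    rw [le_div_iff₀ hUpos]
    nlinarith
  have hz : (N : ℝ) ^ ((1 : ℝ) / slowDegree N) = Real.exp (Real.log N / slowDegree N) := by
    rw [Real.rpow_def_of_pos hN0]
    congr 1
    ring
  rw [hz]
  calc c ≤ (slowDegree N : ℝ) := hcU'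
    _ ≤ Real.log N / slowDegree N + 1 := by linarith
    _ ≤ Real.exp (Real.log N / slowDegree N) := Real.add_one_le_exp _

/-! ## (a), (b): degenerate primes, local obstructions, Euler ratio -/

/-- **Empty sections on a local obstruction** (`𝔖(Ψ₋ᵢ) = 0`), given `max(t+1, L) + 2 ≤ N^{1/u}`: the
obstruction sits at a prime `p ≤ max(t, L) < N^{1/u}` dividing a frozen form at every lattice point
(`EulerRatioAux.exists_small_prime_dvd`), so no point of the section is `N^{1/u}`-rough
(`EulerRatioAux.sectionMass_eq_zero`). -/
theorem sectionMass_eq_zero_of_obstructed {t L N u : ℕ} (Ψ : Fin (t + 1) → AffLinForm 1)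
    (hΨ : IsNondegenerateSystem Ψ) (hL : affLinSize Ψ N ≤ L) (i : Fin (t + 1))
    (h0 : singularProduct (Fin.removeNth i Ψ) = 0)
    (hroot : ((max (t + 1) L + 2 : ℕ) : ℝ) ≤ (N : ℝ) ^ ((1 : ℝ) / u))
    (K : Set (Fin 1 → ℝ)) (j' : Fin t → ℕ) : sectionMass Ψ K N u i j' 1 = 0 := by
  obtain ⟨p, hp, hpsmall, hdiv⟩ := exists_small_prime_dvd Ψ hΨ hL i h0
  have h2N : (2 : ℝ) ≤ (N : ℝ) ^ ((1 : ℝ) / u) :=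
    le_trans (by exact_mod_cast (by omega : 2 ≤ max (t + 1) L + 2)) hroot
  have hpN : (p : ℝ) < (N : ℝ) ^ ((1 : ℝ) / u) := by
    have hlt : (p : ℝ) < ((max (t + 1) L + 2 : ℕ) : ℝ) := by
      have : p ≤ max (t + 1) L := hpsmall.trans (max_le_max (Nat.le_succ t) le_rfl)
      exact_mod_cast (by omega)
    exact hlt.trans_le hroot
  exact sectionMass_eq_zero Ψ i hp hpN h2N hdiv K j'

/-- **Clause (a) of `PrepAlong`: degenerate cases along the schedule.** For `N ≥ N₀(t, L)` (so that
`max(t+1, L) + 2 ≤ N^{1/U(N)}`): a degenerate prime of the section density (`g(p) = 1`, whence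
`goodCount Ψ p = 0`, `p ≤ max(t+1, L)`, a form divisible by `p` at every lattice point, `H_{Ψ,i} = 0`)
or a local obstruction of `Ψ₋ᵢ` (empty sections, and `C_{(m,j')} ≤ F⁽ⁱ⁾_{j'}`) makes every joint cell at
the coordinate `i` empty and the model factor `H_{Ψ,i} · F⁽ⁱ⁾_{j'}` vanish. Port of the sister's
`stub_prLawTwoPrep` (a) at `u := U(N)`. -/
theorem degenerate (t L : ℕ) : ∃ N₀ : ℕ, ∀ N : ℕ, N₀ ≤ N →
    ∀ Ψ : Fin (t + 1) → AffLinForm 1, IsNondegenerateSystem Ψ → affLinSize Ψ N ≤ L →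
    ∀ (K : Set (Fin 1 → ℝ)) (i : Fin (t + 1)) (j' : Fin t → ℕ),
      ((∃ p : ℕ, p.Prime ∧ sectionDensity Ψ i p = 1) ∨ singularProduct (Fin.removeNth i Ψ) = 0) →
        (∀ m : ℕ, cell Ψ K N (slowDegree N) (i.insertNth m j') = 0) ∧
          sectionH Ψ i * (sectionMass Ψ K N (slowDegree N) i j' 1 : ℝ) = 0 := by
  obtain ⟨N₀, hN₀⟩ := exists_le_rpow_schedule ((max (t + 1) L + 2 : ℕ) : ℝ)
  refine ⟨N₀, fun N hN Ψ hΨ hL K i j' hdeg => ?_⟩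
  have hroot : ((max (t + 1) L + 2 : ℕ) : ℝ) ≤ (N : ℝ) ^ ((1 : ℝ) / slowDegree N) := hN₀ N hN
  have h2N : (2 : ℝ) ≤ (N : ℝ) ^ ((1 : ℝ) / slowDegree N) :=
    le_trans (by exact_mod_cast (by omega : 2 ≤ max (t + 1) L + 2)) hroot
  rcases hdeg with ⟨p, hp, h1⟩ | h0
  · -- a degenerate prime of the density
    haveI := Fact.mk hp
    have hG := goodCount_eq_zero_of_density_one Ψ i h1
    obtain ⟨hpsmall, hdiv⟩ := small_and_dvd_of_goodCount_eq_zero Ψ hΨ hL hG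
    have hpN : (p : ℝ) < (N : ℝ) ^ ((1 : ℝ) / slowDegree N) := by
      have hlt : (p : ℝ) < ((max (t + 1) L + 2 : ℕ) : ℝ) := by exact_mod_cast (by omega)
      exact hlt.trans_le hroot
    exact ⟨fun m => cell_eq_zero_of_forall_dvd Ψ hp hpN h2N hdiv K _,
      by rw [sectionH_eq_zero_of_density_one Ψ i hp h1, zero_mul]⟩
  · -- a local obstruction of the frozen sub-system
    have hB := sectionMass_eq_zero_of_obstructed Ψ hΨ hL i h0 hroot K j'
    refine ⟨fun m => ?_, by rw [hB, Nat.cast_zero, mul_zero]⟩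
    have := cell_le_sectionMass Ψ K h2N i j' m
    omega

/-- **Clause (b) of `PrepAlong`: the Euler ratio along the schedule.** For `N ≥ N₀(t, L)`:
`𝔖(Ψ₋ᵢ) ≠ 0 → H_{Ψ,i} = 𝔖(Ψ)/𝔖(Ψ₋ᵢ)` (the landed `u`-free `EulerRatioAux.sectionH_eq`), and
`𝔖(Ψ₋ᵢ) = 0 →` every fibre mass at roughness `U(N)` vanishes (threshold as in (a)). -/
theorem eulerRatio (t L : ℕ) : ∃ N₀ : ℕ, ∀ N : ℕ, N₀ ≤ N →
    ∀ Ψ : Fin (t + 1) → AffLinForm 1, IsNondegenerateSystem Ψ → affLinSize Ψ N ≤ L →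
    ∀ i : Fin (t + 1),
      (singularProduct (Fin.removeNth i Ψ) ≠ 0 →
          sectionH Ψ i = singularProduct Ψ / singularProduct (Fin.removeNth i Ψ)) ∧
      (singularProduct (Fin.removeNth i Ψ) = 0 →
          ∀ (K : Set (Fin 1 → ℝ)) (j' : Fin t → ℕ), sectionMass Ψ K N (slowDegree N) i j' 1 = 0) := by
  obtain ⟨N₀, hN₀⟩ := exists_le_rpow_schedule ((max (t + 1) L + 2 : ℕ) : ℝ)
  exact ⟨N₀, fun N hN Ψ hΨ hL i => ⟨fun hne => sectionH_eq Ψ hΨ i hne,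
    fun h0 K j' => sectionMass_eq_zero_of_obstructed Ψ hΨ hL i h0 (hN₀ N hN) K j'⟩⟩

/-! ## (c): the fibre-mass bound from the sub-system law -/

/-- **The budget arithmetic of (c).** With `ℓ = log N > 1`, `Q = ℓ^{ε/4} ≥ 2^{t+2} C + 2`,
`(log ℓ)^{t-1} ≤ Q`: if `|W| ≤ 2^{t+1}`, `0 ≤ A ≤ 2N`, `0 ≤ S ≤ C (log ℓ)^{t-1}`, `0 ≤ P ≤ Q/ℓ^t`, then
`W · (A S P) + N/(ℓ^t ℓ^δ) ≤ (2^{t+2} C (log ℓ)^{t-1} Q + 1) N/ℓ^t ≤ (Q³ + 1) N/ℓ^t ≤ Q⁴ N/ℓ^t = N ℓ^ε/ℓ^t`. -/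
theorem budget_le {t : ℕ} {N ℓ ε δ C W A S P : ℝ} (hℓ : 1 < ℓ) (hN : 0 ≤ N) (hδ : 0 < δ)
    (hC : 0 ≤ C) (hW : |W| ≤ 2 ^ (t + 1)) (hA0 : 0 ≤ A) (hA : A ≤ 2 * N) (hS0 : 0 ≤ S)
    (hS : S ≤ C * Real.log ℓ ^ (t - 1)) (hP0 : 0 ≤ P) (hP : P ≤ ℓ ^ (ε / 4) / ℓ ^ t)
    (hlog : Real.log ℓ ^ (t - 1) ≤ ℓ ^ (ε / 4)) (hbig : 2 ^ (t + 2) * C + 2 ≤ ℓ ^ (ε / 4)) :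
    W * (A * S * P) + N / (ℓ ^ t * ℓ ^ δ) ≤ N * ℓ ^ ε / ℓ ^ t := by
  have hℓ0 : 0 < ℓ := one_pos.trans hℓ
  obtain ⟨Q, hQ⟩ : ∃ Q : ℝ, ℓ ^ (ε / 4) = Q := ⟨_, rfl⟩
  rw [hQ] at hP hlog hbig
  have h2C : (0 : ℝ) ≤ 2 ^ (t + 2) * C := by positivity
  have hQ2 : 2 ≤ Q := by linarith
  have hQ1 : 1 ≤ Q := by linarith
  have hQ0 : 0 ≤ Q := by linarith
  have hQ4 : ℓ ^ ε = Q ^ 4 := by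
    rw [← hQ, ← Real.rpow_natCast, ← Real.rpow_mul hℓ0.le]
    congr 1
    push_cast
    ring
  have hlog0 : 0 ≤ Real.log ℓ ^ (t - 1) := pow_nonneg (Real.log_nonneg hℓ.le) _
  have hℓt : 0 < ℓ ^ t := pow_pos hℓ0 t
  have hℓδ : 1 ≤ ℓ ^ δ := Real.one_le_rpow hℓ.le hδ.le
  have hCL0 : 0 ≤ C * Real.log ℓ ^ (t - 1) := mul_nonneg hC hlog0
  have h2N0 : (0 : ℝ) ≤ 2 * N := by positivity
  -- the main term
  have hAS : A * S ≤ 2 * N * (C * Real.log ℓ ^ (t - 1)) := mul_le_mul hA hS hS0 h2N0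
  have hASP : A * S * P ≤ 2 * N * (C * Real.log ℓ ^ (t - 1)) * (Q / ℓ ^ t) :=
    mul_le_mul hAS hP hP0 (mul_nonneg h2N0 hCL0)
  have hM0 : 0 ≤ A * S * P := mul_nonneg (mul_nonneg hA0 hS0) hP0
  have h1 : W * (A * S * P) ≤ 2 ^ (t + 1) * (2 * N * (C * Real.log ℓ ^ (t - 1)) * (Q / ℓ ^ t)) :=
    calc W * (A * S * P) ≤ |W| * (A * S * P) := mul_le_mul_of_nonneg_right (le_abs_self W) hM0
      _ ≤ 2 ^ (t + 1) * (2 * N * (C * Real.log ℓ ^ (t - 1)) * (Q / ℓ ^ t)) :=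
          mul_le_mul hW hASP hM0 (by positivity)
  -- the error term
  have h2 : N / (ℓ ^ t * ℓ ^ δ) ≤ N / ℓ ^ t :=
    div_le_div_of_nonneg_left hN hℓt (le_mul_of_one_le_right hℓt.le hℓδ)
  -- the numerics `2^{t+2} C (log ℓ)^{t-1} Q + 1 ≤ Q⁴`
  have hkey : 2 ^ (t + 1) * (2 * (C * Real.log ℓ ^ (t - 1)) * Q) + 1 ≤ Q ^ 4 := by
    have hc : 2 ^ (t + 1) * (2 * C) ≤ Q := by
      have e : (2 : ℝ) ^ (t + 1) * (2 * C) = 2 ^ (t + 2) * C := by ring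
      linarith
    have h3 : 2 ^ (t + 1) * (2 * (C * Real.log ℓ ^ (t - 1)) * Q) ≤ Q * Q * Q := by
      have e : (2 : ℝ) ^ (t + 1) * (2 * (C * Real.log ℓ ^ (t - 1)) * Q) =
          2 ^ (t + 1) * (2 * C) * Real.log ℓ ^ (t - 1) * Q := by ring
      rw [e]
      exact mul_le_mul_of_nonneg_right (mul_le_mul hc hlog hlog0 hQ0) hQ0
    have hQQQ : 1 ≤ Q * Q * Q :=
      one_le_mul_of_one_le_of_one_le (one_le_mul_of_one_le_of_one_le hQ1 hQ1) hQ1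
    have hQ3 : 0 ≤ Q * Q * Q := by positivity
    have h4 : Q ^ 4 = Q * (Q * Q * Q) := by ring
    rw [h4]
    linarith [mul_le_mul_of_nonneg_right hQ2 hQ3]
  -- assembling
  calc W * (A * S * P) + N / (ℓ ^ t * ℓ ^ δ)
      ≤ 2 ^ (t + 1) * (2 * N * (C * Real.log ℓ ^ (t - 1)) * (Q / ℓ ^ t)) + N / ℓ ^ t :=
        add_le_add h1 h2
    _ = (2 ^ (t + 1) * (2 * (C * Real.log ℓ ^ (t - 1)) * Q) + 1) * (N / ℓ ^ t) := by ring
    _ ≤ Q ^ 4 * (N / ℓ ^ t) := mul_le_mul_of_nonneg_right hkey (div_nonneg hN hℓt.le)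
    _ = N * ℓ ^ ε / ℓ ^ t := by rw [hQ4]; ring

/-- **Clause (c) of `PrepAlong`: the fibre-mass bound along the schedule.** Given `DensityBoundsAlong`
and `LawSavAt t` (`t ≥ 1`), for every `L`, `ε > 0` and `N ≥ N₀`: `F⁽ⁱ⁾_{j'} ≤ N (log N)^ε/log^t N` for
every non-degenerate `(t+1)`-form system of size `≤ L`, convex `K ⊆ [-N, N]`, coordinate `i` and frozen
cells `j' ∈ [1, U(N)]^t`. The fibre mass is the `t`-form cell of `Ψ₋ᵢ` over the convex half-body
`K ∩ {ψ_i > 0}` (`sectionMass_one_eq_cell`; `Ψ₋ᵢ` non-degenerate of size `≤ L`, the half-body convex and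
inside the box), priced by `LawSavAt t`; then `budget_le` with `|W_θ| ≤ 2^{t+1}`, `β_∞ ≤ 2N`,
`𝔖(Ψ₋ᵢ) ≤ C (log log N)^{t-1}`, `∏ a ≤ ((log N)^{ε/(4t)}/log N)^t = (log N)^{ε/4}/log^t N`. -/
theorem fibreMass (hDens : DensityBoundsAlong) (t : ℕ) (ht : 1 ≤ t) (hLaw : LawSavAt t) (L : ℕ)
    (ε : ℝ) (hε : 0 < ε) :
    ∃ N₀ : ℕ, ∀ N : ℕ, N₀ ≤ N →
      ∀ Ψ : Fin (t + 1) → AffLinForm 1, IsNondegenerateSystem Ψ → affLinSize Ψ N ≤ L →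
      ∀ K : Set (Fin 1 → ℝ), Convex ℝ K → K ⊆ realBox 1 N →
      ∀ i : Fin (t + 1), ∀ j' : Fin t → ℕ, (∀ k, 1 ≤ j' k ∧ j' k ≤ slowDegree N) →
        (sectionMass Ψ K N (slowDegree N) i j' 1 : ℝ) ≤ (N : ℝ) * Real.log N ^ ε / Real.log N ^ t := by
  obtain ⟨δ, hδ, N₁, hN₁⟩ := hLaw L
  obtain ⟨C, hC, N₂, hN₂⟩ := stub_singularProduct_le_loglog_pow t L ht
  have ht0 : (0 : ℝ) < t := by exact_mod_cast ht
  have ht0' : (t : ℝ) ≠ 0 := ht0.ne'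
  obtain ⟨N₃, hN₃⟩ := hDens (ε / (4 * t)) (by positivity)
  obtain ⟨N₄, hN₄⟩ := exists_thresholds (by positivity : 0 < ε / 4) (by positivity : 0 < ε / 4)
    (t - 1) (2 ^ (t + 2) * C + 2)
  refine ⟨max (max N₁ N₂) (max N₃ N₄), fun N hN Ψ hΨ hL K hK hKN i j' hj' => ?_⟩
  have hN₁N : N₁ ≤ N := le_trans (le_trans (le_max_left _ _) (le_max_left _ _)) hN
  have hN₂N : N₂ ≤ N := le_trans (le_trans (le_max_right _ _) (le_max_left _ _)) hN
  have hN₃N : N₃ ≤ N := le_trans (le_trans (le_max_left _ _) (le_max_right _ _)) hN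
  have hN₄N : N₄ ≤ N := le_trans (le_trans (le_max_right _ _) (le_max_right _ _)) hN
  obtain ⟨hℓ1, hlogD, hbig⟩ := hN₄ N hN₄N
  have hℓ0 : 0 < Real.log N := one_pos.trans hℓ1
  -- the sub-system over the half-body
  have hΦ : IsNondegenerateSystem (Fin.removeNth i Ψ) := isNondegenerateSystem_removeNth hΨ i
  have hΦL : affLinSize (Fin.removeNth i Ψ) N ≤ L := (affLinSize_removeNth_le Ψ i N).trans hL
  have hK'c : Convex ℝ (K ∩ {x | 0 < (Ψ i).realEval x}) := convex_inter_realEval_pos (Ψ i) hK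
  have hK'N : K ∩ {x | 0 < (Ψ i).realEval x} ⊆ realBox 1 N := Set.inter_subset_left.trans hKN
  obtain ⟨θ, hθ0, hθb, hθ⟩ := hN₁ N hN₁N (Fin.removeNth i Ψ) hΦ hΦL _ hK'c hK'N
  have hcell := (abs_le.mp (hθ j' hj')).2
  -- the four factors
  have hW : |walsh θ j'| ≤ 2 ^ (t + 1) := by
    have h := ParityWalsh.abs_walshSum_le θ hθ0 hθb j'
    unfold walsh
    linarith
  have hA : archFactor (Fin.removeNth i Ψ) (K ∩ {x | 0 < (Ψ i).realEval x}) ≤ 2 * N := by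
    rw [archFactor_removeNth_inter]
    exact archFactor_le_two_mul Ψ hKN
  have hA0 : 0 ≤ archFactor (Fin.removeNth i Ψ) (K ∩ {x | 0 < (Ψ i).realEval x}) :=
    archFactor_nonneg _ _
  have hS : singularProduct (Fin.removeNth i Ψ) ≤ C * Real.log (Real.log N) ^ (t - 1) :=
    hN₂ N hN₂N (Fin.removeNth i Ψ) hΦ hΦL
  have hS0 : 0 ≤ singularProduct (Fin.removeNth i Ψ) := singularProduct_nonneg hΦ
  obtain ⟨hdens_le, -, -⟩ := hN₃ N hN₃N
  have hP0 : 0 ≤ ∏ k, modelDensity N (slowDegree N) (j' k) :=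
    Finset.prod_nonneg fun k _ => modelDensity_nonneg N (slowDegree N) (j' k)
  have hexp : ε / (4 * (t : ℝ)) * (t : ℝ) = ε / 4 := by
    field_simp
  have hP : ∏ k, modelDensity N (slowDegree N) (j' k) ≤ Real.log N ^ (ε / 4) / Real.log N ^ t := by
    calc ∏ k, modelDensity N (slowDegree N) (j' k)
        ≤ ∏ _k : Fin t, (Real.log N ^ (ε / (4 * t)) / Real.log N) :=
          Finset.prod_le_prod (fun k _ => modelDensity_nonneg N (slowDegree N) (j' k))
            (fun k _ => hdens_le (j' k))
      _ = (Real.log N ^ (ε / (4 * t)) / Real.log N) ^ t := by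
          rw [Finset.prod_const, Finset.card_univ, Fintype.card_fin]
      _ = Real.log N ^ (ε / 4) / Real.log N ^ t := by
          rw [div_pow, ← Real.rpow_natCast (Real.log N ^ (ε / (4 * t))) t,
            ← Real.rpow_mul hℓ0.le, hexp]
  -- conclusion
  rw [sectionMass_one_eq_cell]
  have h1 : (cell (Fin.removeNth i Ψ) (K ∩ {x | 0 < (Ψ i).realEval x}) N (slowDegree N) j' : ℝ) ≤
      walsh θ j' * (archFactor (Fin.removeNth i Ψ) (K ∩ {x | 0 < (Ψ i).realEval x}) *
        singularProduct (Fin.removeNth i Ψ) * ∏ k, modelDensity N (slowDegree N) (j' k)) +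
        (N : ℝ) / (Real.log N ^ t * Real.log N ^ δ) := by
    linarith
  exact h1.trans (budget_le hℓ1 (Nat.cast_nonneg N) hδ hC.le hW hA0 hA hS0 hS hP0 hP hlogD hbig)

end PrepAlongAux

/-- **`stub_prepAlong`** (registered stub of the line `superpoly-band-same-atom`, skeleton v2): the
preparations `PrepAlong` along the schedule `u = U(N) = slowDegree N` — (a) degenerate primes and local
obstructions (empty joint cells, vanishing model factor `H_{Ψ,i} · F⁽ⁱ⁾_{j'}`, for `N ≥ N₀(t, L)` with
`max(t+1, L) + 2 ≤ N^{1/U(N)}`), (b) the Euler ratio `H_{Ψ,i} = 𝔖(Ψ)/𝔖(Ψ₋ᵢ)` off local obstructions and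
empty fibres on them, (c) the fibre-mass bound `F⁽ⁱ⁾_{j'} ≤ N (log N)^ε/log^t N` from the anatomy bounds
along the schedule and the law for `t`-form sub-systems. -/
theorem stub_prepAlong : PrepAlong :=
  ⟨PrepAlongAux.degenerate, PrepAlongAux.eulerRatio, PrepAlongAux.fibreMass⟩

end Summit.Parity.GeneralizedHardyLittlewood.Cruxes.CellParityLawSaving.SuperPolyBand

end
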